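import Literature.MathematicalPhysics.QuantumLattice.DWaveNodalShellVolume
import HarnessLib

/-!
# Dirac cones of the `d`-wave BdG band: `(ε-μ)² + Δ²d² ≍ (r - u_μ(θ))² + Δ² cos² 2θ`

Topic `Literature/MathematicalPhysics/QuantumLattice`; pointwise companion of `DWaveNodalShellVolume`
(nodal shell-volume estimate) in the polar Fermi-geometry of `HubbardFermiRadiusBand*` /
`HubbardBandShellVolume` (band Fermi radius `u_ν(θ) = bandFermiRadius ν θ` of
`ε(k) = -2(cos k₁ + cos k₂)`, radial derivative `∂_t F(θ, u) ≥ m > 0` on compact sub-bands).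

For points `k = (r cos θ, r sin θ)` of the square `[-π, π]²` whose band energy lies in a compact
sub-band `[a, b] ⊂ (-4, 0)`, and levels `μ ∈ [a, b]`, the squared Bogoliubov–de Gennes energy
`E² = (ε(k) - μ)² + Δ² (cos k₁ - cos k₂)²` is comparable, with constants depending only on `(a, b)`,
to the "cone" quadratic form `(r - u_μ(θ))² + Δ² cos²(2θ)` — radial distance to the Fermi curve plus
gap times angular distance to the diagonals: the four nodes `θ ∈ {±π/4, ±3π/4}`, `r = u_μ(θ)` are
non-degenerate zeros (anisotropic Dirac cones with velocities `≍ 1` and `≍ Δ`), uniformly in the gap: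

* `exists_radial_slope_lower` — **the band rises at rate `≥ m` along rays inside the sub-band**:
  `m (r₂ - r₁) ≤ F(θ, r₂) - F(θ, r₁)` whenever `0 ≤ r₁ ≤ r₂`, `r₂ ‖dir θ‖_∞ ≤ π` and
  `a ≤ F(θ, r₁)`, `F(θ, r₂) ≤ b` (mean value theorem; every intermediate radius is a band Fermi radius
  `u_ν(θ)`, `ν ∈ [a, b]`, where `∂_t F ≥ m` by `exists_pos_le_rayDispersionDt`);
* `abs_rayDispersion_sub_le` — `|F(θ, r) - F(θ, r')| ≤ 4 |r - r'|` (the band is `4`-Lipschitz radially);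
* `abs_dWave_le_mul_abs_cos_two_mul` — `|cos k₁ - cos k₂| ≤ (r²/2) |cos 2θ|` (`|sin x| ≤ |x|` in the
  factorisation `cos k₁ - cos k₂ = -2 sin((k₁+k₂)/2) sin((k₁-k₂)/2)`);
* `exists_nodalCone_lower` — **lower cone bound**: `c ((r - u_μ(θ))² + Δ² cos² 2θ) ≤ E²` with
  `c = c(a, b) > 0`, for all gaps `Δ`;
* `nodalCone_upper` — **upper cone bound**: `E² ≤ 1024 ((r - u_μ(θ))² + Δ² cos² 2θ)`.

This is the non-degeneracy of the nodal points that underlies the infrared (Dirac) power counting of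
the interacting `d`-wave problem and the change of variables to cone coordinates near each node.
Everything is proved; no definitions. [folklore]

## Sources

Folklore (nodal `d`-wave quasi-particles: A. C. Durst, P. A. Lee, Phys. Rev. B 62 (2000) 1270, §II,
`E_k ≃ √(v_F² k₁² + v_Δ² k₂²)`); polar Fermi geometry after G. Benfatto, A. Giuliani, V. Mastropietro,
Ann. Henri Poincaré 7 (2006) 809, §1 (`BenfattoGiulianiMastropietro2006`).

## Mathlib / tree search

`lean search "nodalCone|radial_slope|rayDispersionDt"` — `HubbardBandShellVolume.exists_pos_le_rayDispersionDt`
(positive radial derivative on compact sub-bands), `strictMonoOn_rayDispersion_band`; no quantitative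
slope or cone bound.
-/

noncomputable section

open Real Set Filter
open scoped Topology

namespace Literature.MathematicalPhysics.QuantumLattice

/-! ### The band rises at a definite rate along rays inside a compact sub-band -/

/-- **Radial slope lower bound.** For `-4 < a`, `b < 0` there is `m > 0` such that along every ray
`θ ∈ [-π, π]`, for radii `0 ≤ r₁ ≤ r₂` with `r₂ ‖dir θ‖_∞ ≤ π` (inside the square) and
`a ≤ F(θ, r₁)`, `F(θ, r₂) ≤ b`: `m (r₂ - r₁) ≤ F(θ, r₂) - F(θ, r₁)`. [folklore] -/
theorem exists_radial_slope_lower {a b : ℝ} (ha : -4 < a) (hb : b < 0) :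
    ∃ m : ℝ, 0 < m ∧ ∀ θ ∈ Icc (-π) π, ∀ r₁ r₂ : ℝ, 0 ≤ r₁ → r₁ ≤ r₂ → r₂ * ‖dir θ‖ ≤ π →
      a ≤ rayDispersion (θ, r₁) → rayDispersion (θ, r₂) ≤ b →
      m * (r₂ - r₁) ≤ rayDispersion (θ, r₂) - rayDispersion (θ, r₁) := by
  obtain ⟨m, hm0, hm⟩ := exists_pos_le_rayDispersionDt ha hb
  refine ⟨m, hm0, fun θ hθ r₁ r₂ hr₁ h12 hr₂ hlo hhi => ?_⟩
  have hn := norm_dir_pos θ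
  set f : ℝ → ℝ := fun t => rayDispersion (θ, t) with hf
  have hderiv : ∀ t, HasDerivAt f (rayDispersionDt θ t) t := fun t => hasDerivAt_rayDispersion_radius θ t
  have hcont : ContinuousOn f (Icc r₁ r₂) := fun t _ => (hderiv t).continuousAt.continuousWithinAt
  have hdiff : DifferentiableOn ℝ f (interior (Icc r₁ r₂)) := fun t _ =>
    (hderiv t).differentiableAt.differentiableWithinAt
  have hmono := strictMonoOn_rayDispersion_band θ
  have hr₂m : r₂ ∈ Icc 0 (π / ‖dir θ‖) := ⟨hr₁.trans h12, by rw [le_div_iff₀ hn]; exact hr₂⟩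
  have hr₁m : r₁ ∈ Icc 0 (π / ‖dir θ‖) := ⟨hr₁, h12.trans hr₂m.2⟩
  have hge : ∀ t ∈ interior (Icc r₁ r₂), m ≤ deriv f t := by
    rw [interior_Icc]
    intro t ht
    rw [(hderiv t).deriv]
    have htm : t ∈ Icc 0 (π / ‖dir θ‖) := ⟨hr₁.trans ht.1.le, ht.2.le.trans hr₂m.2⟩
    -- the level at radius `t` lies in `[a, b]`
    set ν : ℝ := rayDispersion (θ, t) with hν
    have hν₁ : a ≤ ν := hlo.trans (hmono.le_iff_le hr₁m htm |>.2 ht.1.le)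
    have hν₂ : ν ≤ b := (hmono.le_iff_le htm hr₂m |>.2 ht.2.le).trans hhi
    have hν4 : -4 < ν := ha.trans_le hν₁
    have hν0 : ν < 0 := hν₂.trans_lt hb
    -- so `t` is the band Fermi radius of level `ν`
    have hroot : IsBandFermiRadius ν θ t :=
      ⟨⟨htm.1, by rw [← le_div_iff₀ hn]; exact htm.2⟩, rfl⟩
    have ht_eq : t = bandFermiRadius ν θ := bandFermiRadius_unique hν4 hν0 hroot
    have h := hm ν ⟨hν₁, hν₂⟩ θ hθ
    rwa [← ht_eq] at h
  exact (convex_Icc r₁ r₂).mul_sub_le_image_sub_of_le_deriv hcont hdiff hge r₁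
    (left_mem_Icc.2 h12) r₂ (right_mem_Icc.2 h12) h12

/-- The band is `4`-Lipschitz along rays: `|F(θ, r) - F(θ, r')| ≤ 4 |r - r'|`. [folklore] -/
theorem abs_rayDispersion_sub_le (θ r r' : ℝ) :
    |rayDispersion (θ, r) - rayDispersion (θ, r')| ≤ 4 * |r - r'| := by
  rw [rayDispersion_eq, rayDispersion_eq]
  simp only
  have h1 := Real.abs_cos_sub_cos_le (r * Real.cos θ) (r' * Real.cos θ)
  have h2 := Real.abs_cos_sub_cos_le (r * Real.sin θ) (r' * Real.sin θ)
  have h1' : |r * Real.cos θ - r' * Real.cos θ| ≤ |r - r'| := by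
    rw [← sub_mul, abs_mul]
    exact mul_le_of_le_one_right (abs_nonneg _) (Real.abs_cos_le_one θ)
  have h2' : |r * Real.sin θ - r' * Real.sin θ| ≤ |r - r'| := by
    rw [← sub_mul, abs_mul]
    exact mul_le_of_le_one_right (abs_nonneg _) (Real.abs_sin_le_one θ)
  have e : -2 * (Real.cos (r * Real.cos θ) + Real.cos (r * Real.sin θ)) -
      -2 * (Real.cos (r' * Real.cos θ) + Real.cos (r' * Real.sin θ)) =
      (-2) * ((Real.cos (r * Real.cos θ) - Real.cos (r' * Real.cos θ)) +
        (Real.cos (r * Real.sin θ) - Real.cos (r' * Real.sin θ))) := by ring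
  rw [e, abs_mul, abs_neg, abs_two]
  have := abs_add_le (Real.cos (r * Real.cos θ) - Real.cos (r' * Real.cos θ))
    (Real.cos (r * Real.sin θ) - Real.cos (r' * Real.sin θ))
  linarith

/-- The `d`-wave factor is dominated by the distance to the diagonals:
`|cos k₁ - cos k₂| ≤ (r²/2) |cos 2θ|` for `k = (r cos θ, r sin θ)`. [folklore] -/
theorem abs_dWave_le_mul_abs_cos_two_mul (r θ : ℝ) :
    |Real.cos (r * Real.cos θ) - Real.cos (r * Real.sin θ)| ≤ r ^ 2 / 2 * |Real.cos (2 * θ)| := by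
  set k₁ : ℝ := r * Real.cos θ with hk₁
  set k₂ : ℝ := r * Real.sin θ with hk₂
  rw [Real.cos_sub_cos k₁ k₂, abs_mul, abs_mul, abs_neg, abs_two]
  have hX := Real.abs_sin_le_abs (x := (k₁ + k₂) / 2)
  have hY := Real.abs_sin_le_abs (x := (k₁ - k₂) / 2)
  have hprod : |(k₁ + k₂) / 2| * |(k₁ - k₂) / 2| = r ^ 2 * |Real.cos (2 * θ)| / 4 := by
    rw [← abs_mul, Real.cos_two_mul']
    have e : (k₁ + k₂) / 2 * ((k₁ - k₂) / 2) = r ^ 2 * (Real.cos θ ^ 2 - Real.sin θ ^ 2) / 4 := by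
      rw [hk₁, hk₂]; ring
    rw [e, abs_div, abs_mul, abs_of_nonneg (sq_nonneg r), abs_of_pos (by norm_num : (0:ℝ) < 4)]
  calc 2 * |Real.sin ((k₁ + k₂) / 2)| * |Real.sin ((k₁ - k₂) / 2)|
      ≤ 2 * |(k₁ + k₂) / 2| * |(k₁ - k₂) / 2| := by gcongr
    _ = r ^ 2 / 2 * |Real.cos (2 * θ)| := by rw [mul_assoc, hprod]; ring

/-! ### The two-sided cone bound -/

/-- **Lower cone bound at the nodes.** For `-4 < a`, `b < 0` there is `c > 0` such that for every level
`μ ∈ [a, b]`, every gap `Δ`, and every point `k = (r cos θ, r sin θ)` (`r > 0`, `θ ∈ [-π, π]`) of the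
square `|kᵢ| ≤ π` with `a ≤ ε(k) ≤ b`:
`c ((r - u_μ(θ))² + (Δ cos 2θ)²) ≤ (ε(k) - μ)² + (Δ (cos k₁ - cos k₂))²`. [folklore] -/
theorem exists_nodalCone_lower {a b : ℝ} (ha : -4 < a) (hb : b < 0) :
    ∃ c : ℝ, 0 < c ∧ ∀ μ ∈ Icc a b, ∀ Δ r θ : ℝ, 0 < r → θ ∈ Icc (-π) π →
      |r * Real.cos θ| ≤ π → |r * Real.sin θ| ≤ π →
      a ≤ rayDispersion (θ, r) → rayDispersion (θ, r) ≤ b →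
      c * ((r - bandFermiRadius μ θ) ^ 2 + (Δ * Real.cos (2 * θ)) ^ 2) ≤
        (rayDispersion (θ, r) - μ) ^ 2 +
          (Δ * (Real.cos (r * Real.cos θ) - Real.cos (r * Real.sin θ))) ^ 2 := by
  obtain ⟨m, hm0, hm⟩ := exists_radial_slope_lower ha hb
  obtain ⟨κ, hκ0, hκ⟩ := exists_mul_abs_cos_two_mul_le_abs_dWave ha hb
  refine ⟨min (m ^ 2) (κ ^ 2), lt_min (by positivity) (by positivity),
    fun μ hμ Δ r θ hr hθ hx hy hlo hhi => ?_⟩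
  have hμ4 : -4 < μ := ha.trans_le hμ.1
  have hμ0 : μ < 0 := hμ.2.trans_lt hb
  set u : ℝ := bandFermiRadius μ θ with hu
  have huroot := isBandFermiRadius_bandFermiRadius hμ4 hμ0 θ
  have hu0 : 0 ≤ u := huroot.1.1
  have huπ : u * ‖dir θ‖ ≤ π := huroot.1.2
  have hFu : rayDispersion (θ, u) = μ := huroot.2
  have hrπ : r * ‖dir θ‖ ≤ π := (polar_mem_square_bounds hr hx hy).1
  -- radial part: `|F(r) - μ| ≥ m |r - u|`
  have hrad : m ^ 2 * (r - u) ^ 2 ≤ (rayDispersion (θ, r) - μ) ^ 2 := by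
    rcases le_total r u with hru | hur
    · have h := hm θ hθ r u hr.le hru huπ hlo (by rw [hFu]; exact hμ.2)
      rw [hFu] at h
      have h' : m * (u - r) ≤ |rayDispersion (θ, r) - μ| := by
        rw [abs_sub_comm]; exact h.trans (le_abs_self _)
      have h0 : 0 ≤ m * (u - r) := mul_nonneg hm0.le (by linarith)
      calc m ^ 2 * (r - u) ^ 2 = (m * (u - r)) ^ 2 := by ring
        _ ≤ |rayDispersion (θ, r) - μ| ^ 2 := pow_le_pow_left₀ h0 h' 2
        _ = (rayDispersion (θ, r) - μ) ^ 2 := sq_abs _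
    · have h := hm θ hθ u r hu0 hur hrπ (by rw [hFu]; exact hμ.1) hhi
      rw [hFu] at h
      have h' : m * (r - u) ≤ |rayDispersion (θ, r) - μ| := h.trans (le_abs_self _)
      have h0 : 0 ≤ m * (r - u) := mul_nonneg hm0.le (by linarith)
      calc m ^ 2 * (r - u) ^ 2 = (m * (r - u)) ^ 2 := by ring
        _ ≤ |rayDispersion (θ, r) - μ| ^ 2 := pow_le_pow_left₀ h0 h' 2
        _ = (rayDispersion (θ, r) - μ) ^ 2 := sq_abs _
  -- angular part: `|d| ≥ κ |cos 2θ|`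
  have hang : κ ^ 2 * (Δ * Real.cos (2 * θ)) ^ 2 ≤
      (Δ * (Real.cos (r * Real.cos θ) - Real.cos (r * Real.sin θ))) ^ 2 := by
    have h := hκ r θ hr.le hx hy (by rw [← rayDispersion_eq (θ, r)]; exact hlo)
      (by rw [← rayDispersion_eq (θ, r)]; exact hhi)
    have h0 : 0 ≤ κ * |Real.cos (2 * θ)| := by positivity
    have h2 := pow_le_pow_left₀ h0 h 2
    rw [mul_pow, sq_abs, sq_abs] at h2
    calc κ ^ 2 * (Δ * Real.cos (2 * θ)) ^ 2 = Δ ^ 2 * (κ ^ 2 * Real.cos (2 * θ) ^ 2) := by ring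
      _ ≤ Δ ^ 2 * (Real.cos (r * Real.cos θ) - Real.cos (r * Real.sin θ)) ^ 2 :=
          mul_le_mul_of_nonneg_left h2 (sq_nonneg Δ)
      _ = (Δ * (Real.cos (r * Real.cos θ) - Real.cos (r * Real.sin θ))) ^ 2 := by ring
  have h1 : min (m ^ 2) (κ ^ 2) * (r - u) ^ 2 ≤ m ^ 2 * (r - u) ^ 2 :=
    mul_le_mul_of_nonneg_right (min_le_left _ _) (sq_nonneg _)
  have h2 : min (m ^ 2) (κ ^ 2) * (Δ * Real.cos (2 * θ)) ^ 2 ≤ κ ^ 2 * (Δ * Real.cos (2 * θ)) ^ 2 :=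
    mul_le_mul_of_nonneg_right (min_le_right _ _) (sq_nonneg _)
  calc min (m ^ 2) (κ ^ 2) * ((r - u) ^ 2 + (Δ * Real.cos (2 * θ)) ^ 2)
      = min (m ^ 2) (κ ^ 2) * (r - u) ^ 2 + min (m ^ 2) (κ ^ 2) * (Δ * Real.cos (2 * θ)) ^ 2 := by ring
    _ ≤ m ^ 2 * (r - u) ^ 2 + κ ^ 2 * (Δ * Real.cos (2 * θ)) ^ 2 := add_le_add h1 h2
    _ ≤ _ := add_le_add hrad hang

/-- **Upper cone bound at the nodes**: for `-4 < μ < 0`, every gap `Δ` and every point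
`k = (r cos θ, r sin θ)` (`r > 0`) of the square `|kᵢ| ≤ π`,
`(ε(k) - μ)² + (Δ (cos k₁ - cos k₂))² ≤ 1024 ((r - u_μ(θ))² + (Δ cos 2θ)²)`
(radial `4`-Lipschitz bound and `|d| ≤ (r²/2)|cos 2θ|`, `r ≤ 8`). [folklore] -/
theorem nodalCone_upper {μ : ℝ} (hμ₁ : -4 < μ) (hμ₂ : μ < 0) {Δ r θ : ℝ} (hr : 0 < r)
    (hx : |r * Real.cos θ| ≤ π) (hy : |r * Real.sin θ| ≤ π) :
    (rayDispersion (θ, r) - μ) ^ 2 + (Δ * (Real.cos (r * Real.cos θ) - Real.cos (r * Real.sin θ))) ^ 2 ≤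
      1024 * ((r - bandFermiRadius μ θ) ^ 2 + (Δ * Real.cos (2 * θ)) ^ 2) := by
  set u : ℝ := bandFermiRadius μ θ with hu
  have hFu : rayDispersion (θ, u) = μ := rayDispersion_bandFermiRadius hμ₁ hμ₂ θ
  have hr8 : r ≤ 8 := (polar_mem_square_bounds hr hx hy).2
  -- radial part
  have hrad : (rayDispersion (θ, r) - μ) ^ 2 ≤ 16 * (r - u) ^ 2 := by
    have h := abs_rayDispersion_sub_le θ r u
    rw [hFu] at h
    have h0 : 0 ≤ 4 * |r - u| := by positivity
    calc (rayDispersion (θ, r) - μ) ^ 2 = |rayDispersion (θ, r) - μ| ^ 2 := (sq_abs _).symm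
      _ ≤ (4 * |r - u|) ^ 2 := pow_le_pow_left₀ (abs_nonneg _) h 2
      _ = 16 * (r - u) ^ 2 := by rw [mul_pow, sq_abs]; norm_num
  -- angular part
  have hang : (Δ * (Real.cos (r * Real.cos θ) - Real.cos (r * Real.sin θ))) ^ 2 ≤
      1024 * (Δ * Real.cos (2 * θ)) ^ 2 := by
    have h := abs_dWave_le_mul_abs_cos_two_mul r θ
    have hr2 : r ^ 2 / 2 ≤ 32 := by nlinarith
    have h' : |Real.cos (r * Real.cos θ) - Real.cos (r * Real.sin θ)| ≤ 32 * |Real.cos (2 * θ)| :=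
      h.trans (mul_le_mul_of_nonneg_right hr2 (abs_nonneg _))
    have h2 := pow_le_pow_left₀ (abs_nonneg _) h' 2
    rw [mul_pow, sq_abs, sq_abs] at h2
    calc (Δ * (Real.cos (r * Real.cos θ) - Real.cos (r * Real.sin θ))) ^ 2
        = Δ ^ 2 * (Real.cos (r * Real.cos θ) - Real.cos (r * Real.sin θ)) ^ 2 := by ring
      _ ≤ Δ ^ 2 * (32 ^ 2 * Real.cos (2 * θ) ^ 2) := mul_le_mul_of_nonneg_left h2 (sq_nonneg Δ)
      _ = 1024 * (Δ * Real.cos (2 * θ)) ^ 2 := by ring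
  nlinarith [hrad, hang, sq_nonneg (r - u), sq_nonneg (Δ * Real.cos (2 * θ))]

end Literature.MathematicalPhysics.QuantumLattice

end
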